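import Literature.MathematicalPhysics.QuantumFieldTheory.Balaban1983to89.Node00.Record12CarriersB12Package
import Literature.MathematicalPhysics.QuantumFieldTheory.Balaban1983to89.Node00.CarriersB12FundamentalCase
import Literature.MathematicalPhysics.QuantumFieldTheory.Balaban1983to89.Node00.Record13CarriersXPinnedH
import Literature.MathematicalPhysics.QuantumFieldTheory.Balaban1983to89.Node00.Record13SepCoPH

/-!
# NODE N09 ([Balaban1987RG1] Lemma 4 (3.53) p. 280), LOCATED RIDER TO FLAG №7 «conjunct-1 JUNK-INHABITED at the unit recipe» — THE JUNK SURVIVES EVERY PIN OF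
# THE RESIDUAL BACKGROUND FUNCTIONS: for EVERY residual §2 recipe `Rz` satisfying the record's OWN proviso `Sect2.Residual.Laws` (ROW P8 `rzLaws`:
# `U_n(M˙(1)) = 1`, `J_n(M˙(1)) = 0` — a field of `Provisos₁₂` ∕ `Provisos₁₃` ∕ `Provisos₁₃SepCoPH`, and a property of print's [15]-minimiser backgrounds), the
# zero-letter layer `𝐊 = 𝐀₂ = 0` STILL inhabits node00-def-B12's honest horn `B12Provisos Rz cB λ`; hence at EVERY parameter of K1⁷'s own antecedent class
# (`θ.Provisos₁₃SepCoPH ∧ θ.Admissible`) some zero-letter `λ₁₂` carries the Stage-12 leaf at every run and meets the four-pin engine's `h09` socket — whatever `θ.Rz` is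

T. Bałaban, *Renormalization group approach to lattice gauge field theories. I*, Commun. Math. Phys. **109** (1987) 249–301 [Balaban1987RG1] (= [I]);
[15] = [Balaban1985Variational], Commun. Math. Phys. **102** (1985) 277–309.  TRACK A (YM-PLAN §2b), WIDTH SEAT `pub-ymgap-dag-n09-w5` (HUMAN RULING D-0154 ∕
director-ym R399 (3a); node n09 is WIDTH-CLOSED in dag-lead's TABLE v63 — this is a LOCATED RIDER to the open FLAG №7 of record, director-ym №209, not a width piece).
Key of record it serves: K1⁷ `StabilityBAtRecordR13SepCoPH` = stmt-QuantumFields-20542 (`--supports`, helper; count-neutral).  Base file (cited, generalised, NOT edited):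
dag-n09-w4 g2's p585162 `Summits/…/Theorems/BalabanUVNodesN09B12ProvisosAtRzOfRecordJunkLocated` (`exists_b12Provisos_RzOfRecord`: the horn is inhabited by zero letters AT
`Rz = RzOfRecord` = the unit recipe).

WHY.  FLAG №7 (director-ym №209, 2026-08-28T03:55Z; = ref-L SECOND-GAP-1 «N09-PACKAGE-FLAT-AT-UNIT-RECIPE») reads p585162 as a defect OF THE UNIT RECIPE and names as cure «node00-def-T ∕
def-B12 PIN `Sect2.Residual.bgI` to the minimisers of record; deliverable = the pinned `Rz` + a re-run of n09-w4's three files at it, with p585162's construction then FAILING,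
stated as a lemma («no zero-letter family satisfies `B12Provisos` at the pinned `Rz`»)».  THIS FILE is the kernel check of that reading.  Reading p585162's proof term: every
use of its hypothesis `Rz = unit` is one of the four faces `U_m(M˙(V)) = 1`, `J_m(M˙(V)) = 0` of the unit recipe applied AT THE UNIT CONFIGURATION `V = 1` ONLY — the
zero letters make the Lemma-4 configuration `V = exp iξ(𝐊 + 𝐀₂) = 1`, the by-reference representative is `Φ₀ = (1, 0)`, and (3.38)×2 is read at `1` — i.e. every use is
an instance of `Sect2.Residual.Laws.bgI_Un_one ∕ bgI_Jn_one`, THE RECORD'S ROW P8 (11c `Sect2FormOfRecord`: «the unit configuration is sent to the unit configuration and to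
the zero current … in print: the unit configuration is the minimiser of its own averages, [15] Thm 1, and `J(1) = 0` by (1.8)» — displayed precisely so that the spaces of
record are non-empty, pub-balaban `B12RegularSpaces111Mono.unitPair_mem_space`).  The input configuration `Φ = (𝐔, 𝐉)` enters p07's by-reference package `JInputs` ONLY
through the residual LETTER MAPS `λ.K Φ 𝐀 τ`, `λ.A₂ Φ 𝐀 τ B′` (free data of node00-def's `ResidB12Run`; `CarriersB12` header: «junk letters 𝐊 = 𝐀₂ = 0 make the leaf TRUE …
wild letters make it FALSE») and NOT through the representative `Φ₀` or the [15]-function `𝐇` (untied fields of `JInputs`).  Consequently: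

WHAT IS PROVED (kernel bookkeeping; theorems only, def-free, sorry-free, standard axioms; nothing of NODE 00 ∕ p07 ∕ pub-balaban re-declared).
* §1 (private) the four faces AT `V = 1` from `Rz.Laws`; `satisfies_unitPair_frameBox_of_laws` (the unit pair meets (i)–(iv) of `U′ᶜ_{k+1}(□₀, ·)` of record over ANY
  `Rz` with `Rz.Laws` — pub-balaban's `unitPair_mem_space` term, kept at `Satisfies` level).
* §2 `nonempty_b12Package_of_laws_of_zero_letters`, ★ `exists_b12Provisos_of_laws` — p585162 §2 with `Rz = unit` REPLACED by `Rz.Laws`; ★ `not_failingLemma_of_laws`: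
  the lemma shape №209 asks for («no zero-letter family satisfies `B12Provisos Rz`») is FALSE at every `Rz` with `Rz.Laws`, `M ≥ 1`, `0 < O(1)LMB`.
* §3 at EVERY `θ : Stage12Params` with row P8 (`∀ K, (θ.Rz K).Laws`; no `HasResidualsOfRecord`): ★★ `exists_lam12_b12Provisos_of_rzLaws`, `exists_lam12_b12LeafOfRecord₁₂_of_rzLaws`,
  and from the record's provisos verbatim `exists_lam12_b12LeafOfRecord₁₂_of_provisos₁₂` (`θ.Provisos₁₂`, `θ.Admissible`, `1 ≤ M`).
* §4 at EVERY `θ : Stage13Params` with row P8: ★★ `exists_lam12_socket09_pinX3H_of_rzLaws` (dag-n05-d's `socket09_pinX3H_iff`, `Iff.rfl`); and at EVERY `θ : Stage13HParams` OF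
  K1⁷'s OWN ANTECEDENT CLASS: ★★★ `exists_lam12_b12LeafOfRecord₁₂_of_provisos₁₃SepCoPH` ∕ `exists_lam12_socket09_pinX3H_of_provisos₁₃SepCoPH` (`θ.Provisos₁₃SepCoPH F N` gives
  `rzLaws` and `M = L^a ≥ 1`; `θ.Admissible F N` gives `0 < O(1)LMB`) — the four-pin engine's N09 socket is met by ZERO letters at every admissible parameter of the class
  the crux quantifies over, for every `λ₈`, `λ₁₃`, every run.
* p585162 §3 (`…_RzOfRecord`, `…_of_hasResidualsOfRecord`, the V17∕V18 witness) is the special case `Sect2.Residual.unit_laws` ∕ `HasResidualsOfRecord.rzLaws` — cited, not restated.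

WHAT THIS MEANS FOR FLAG №7 (located; for director-ym ∕ dag-lead ∕ plan ∕ the def-T ∕ def-B12 desk when it re-seats ∕ referees): (1) the №209 deliverable AS SPECIFIED — «pinned
`Rz` ⇒ p585162's construction FAILS, as a lemma» — is UNOBTAINABLE for every pin that keeps row P8 (`not_failingLemma_of_laws`); a pin violating P8 would contradict print
([15] Thm 1 at the unit coarse field) and empty the record's non-vacuity faces `one_mem_spaceI_stage1x`.  (2) The hollow closure is a property of the RESIDUAL LETTERS and of
the SHAPE of the by-reference package, not of `bgI`: the deliverable that bites is a pin of `λ₁₂`'s letter maps `K ∕ A₂` to (3.26)–(3.30) ∕ (3.47)–(3.50) ([15]'s chart (174);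
node00-def's `ResidB12Run` carrier — its own header asks NODE 00 to «name the NON-trivial package») and∕or a `JInputs` edition tying `Φ₀` ((3.40): the orbit representative OF `Φ`)
and `𝐇 = 𝐇_{k+1}(□₀, (1∕i) log V(𝐔))` to the input `Φ`.  (3) Pinning `bgI` stays NECESSARY for an honest closure — it is what lets PRINT's (non-flat) chart letters meet the identity
fields (3.38) ∕ (3.39)+(3.37) ∕ (3.42) at all (ref-L SECOND-GAP-1 ∕ n09-w4 g2's companion p583808: at the unit recipe those fields certify FLAT letter families only) — but it is NOT
SUFFICIENT against the junk closure: necessary for print's letters to enter, idle against the zero letters.  Nothing here bears on FLAG №3 or on conjunct 2.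

HONEST FRAMING: LOCATED, count-neutral kernel bookkeeping on NODE 00's objects (read BY NAME, nothing re-declared); the zero letters are a witness for the BINDERS, NOT objects
of print — this is NOT Lemma 4 for `U_j(□₀, ·)`; NO estimate of Bałaban's is proved or denied; N09 NOT discharged; FLAG №7 neither closed nor widened (it is re-aimed); K0⁷ ∕ K1⁷
NOT closed; counts unmoved (typed 28∕28 · discharged 5∕27); no summit statement is proved by this seat; one finite four-torus programme at fixed `ε = L^{−K}` per run —
conditional finite-𝕋⁴ bookkeeping; R4 closes rung `BalabanLadder.UV` only; NOT ℝ⁴, NOT infinite volume, NOT OS, NOT a mass gap, NOT Clay.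
-/

noncomputable section

namespace Summit.QuantumFields.YangMills.BalabanUVNodes.N09B12ProvisosJunkUnderRzLaws

open Literature.MathematicalPhysics.QuantumFieldTheory.Balaban1983to89
open Literature.MathematicalPhysics.QuantumFieldTheory.Balaban1983to89.Node00
open Literature.MathematicalPhysics.QuantumFieldTheory.Balaban1983to89.T4Continuum (T4Family)
open B12RegularSpaces111 (Frame Region StepConsts space space' expI grad CondIV Satisfies plaq gaugeU)
open B12RegularSpaces111Mono (plaq_one expI_zero unitPair factors_one condI_one condII_zero condIII_one_zero)
open B12RegularSpaces111Gauge (plaq_gaugeU gaugeU_one)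
open B12Eq18Current (current)
open B12RegularSpaces111SpecialUnitary (suModel)
open B12Lemma4Models (slProj)
open B12Lemma4ConcreteFrame (JInputs LettersAnalyticAt)
open B12Eq311CurrentExpansion (C311)
open scoped Matrix.Norms.L2Operator

/-! ## §1. (private) The four faces of the residual laws AT THE UNIT CONFIGURATION, at the two [B12] frames of record; the unit pair in the upper space of record -/

section Unit

variable {P : Params} {N M : ℕ} {Rz : Sect2.Residual P (MatA N)}

/-- ROW P8 at the frame of `X`: `U_m(M˙(1)) = 1`. [cite: Balaban1987RG1, (1.15) p.262 (bookkeeping)] -/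
private theorem bg_Un_frameX_one (hRz : Rz.Laws) (lam : ResidB12Run P N M) (m : ℕ) :
    (lam.frameX Rz).bg.Un m (1 : PBond P 0 → (MatA N)ˣ) = 1 :=
  hRz.bgI_Un_one _ _ _

/-- ROW P8 at the frame of `X`: `J_m(M˙(1)) = 0`. [cite: Balaban1987RG1, (1.15) p.262 (bookkeeping)] -/
private theorem bg_Jn_frameX_one (hRz : Rz.Laws) (lam : ResidB12Run P N M) (m : ℕ) (b : PBond P 0) :
    (lam.frameX Rz).bg.Jn m (1 : PBond P 0 → (MatA N)ˣ) b = 0 :=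
  hRz.bgI_Jn_one _ _ _ _

/-- ROW P8 at the frame of `□₀`, read at the `𝐔`-component of the unit pair: `U_m(M˙(1)) = 1`. [cite: Balaban1987RG1, (1.15) p.262, p.275 (bookkeeping)] -/
private theorem bg_Un_frameBox_unitPair (hRz : Rz.Laws) (lam : ResidB12Run P N M) (m : ℕ) :
    (lam.frameBox Rz).bg.Un m (unitPair (P := P) (i := 0) (𝔸 := MatA N)).U = 1 :=
  hRz.bgI_Un_one _ _ _

/-- ROW P8 at the frame of `□₀`, read at the `𝐔`-component of the unit pair: `J_m(M˙(1)) = 0`. [cite: Balaban1987RG1, (1.15) p.262, p.275 (bookkeeping)] -/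
private theorem bg_Jn_frameBox_unitPair (hRz : Rz.Laws) (lam : ResidB12Run P N M) (m : ℕ) (b : PBond P 0) :
    (lam.frameBox Rz).bg.Jn m (unitPair (P := P) (i := 0) (𝔸 := MatA N)).U b = 0 :=
  hRz.bgI_Jn_one _ _ _ _

/-- The unit pair `(1, 0)` satisfies (i)–(iv) of the upper space `U′ᶜ_{k+1}(□₀, α₀, α₁, γ₀)` of record over ANY residual recipe obeying row P8 (positive radii, `0 < O(1)LMB`):
pub-balaban's `unitPair_mem_space` term — factorisation `1 = (exp iξ·0)·1`, (i)–(iii) by `condI_one` ∕ `condII_zero` ∕ `condIII_one_zero`, (iv) at `1` by the residual laws —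
kept at the `Satisfies` level the by-reference package asks for. [cite: Balaban1987RG1, (1.11)–(1.16) p.262, (3.40) p.278] -/
private theorem satisfies_unitPair_frameBox_of_laws (hRz : Rz.Laws) (𝓜 : B12RegularSpaces111.Model (MatA N)) (lam : ResidB12Run P N M)
    {cB : ℝ} (hcB : 0 < cB) {α₀ α₁ γ₀ : ℝ} (hα₀ : 0 < α₀) (hα₁ : 0 < α₁) (hγ₀ : 0 < γ₀) :
    Satisfies 𝓜 (lam.frameBox Rz) (lam.csBox cB) α₀ α₁ γ₀ unitPair := by
  have hξ' : 0 < (lam.csBox cB).ξ := pow_pos (inv_pos.mpr (Nat.cast_pos.mpr P.L_pos)) _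
  have hξ : (lam.csBox cB).ξ ≠ 0 := hξ'.ne'
  have hL : 0 < (lam.csBox cB).L := Nat.cast_pos.mpr P.L_pos
  have hIV : CondIV (lam.frameBox Rz).bg (lam.frameBox Rz).X₂ (lam.csBox cB) α₀ (unitPair (P := P) (i := 0) (𝔸 := MatA N)).U := by
    refine ⟨fun n _ _ p _ => ?_, fun n _ _ b _ => ?_⟩
    · rw [bg_Un_frameBox_unitPair hRz, plaq_one, Units.val_one, sub_self, norm_zero]
      positivity
    · rw [bg_Jn_frameBox_unitPair hRz, norm_zero]
      positivity
  exact ⟨fun _ _ => 𝓜.Gc.one_mem, fun _ _ => 𝓜.gc.zero_mem, 1, fun _ => 0, factors_one _, condI_one (𝓜 := 𝓜) _ hξ hcB hα₀,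
    condII_zero (𝓜 := 𝓜) _ _ hα₁ 1, condIII_one_zero _ hξ hα₀ hγ₀, hIV, hIV⟩

end Unit

/-! ## §2. The zero-letter `JInputs` and the package over ANY residual recipe obeying row P8; the honest horn `B12Provisos` inhabited; the «failing lemma» is false -/

section Junk

variable {P : Params} {N M : ℕ} [NeZero N] {Rz : Sect2.Residual P (MatA N)}

omit [NeZero N] in
/-- `exp iξ·0 = 1` as a configuration. [cite: Balaban1987RG1, (1.13) p.262 (bookkeeping)] -/
private theorem expI_zero_cfg (ξ : ℝ) : (fun b : PBond P 0 => expI ξ ((0 : PBond P 0 → MatA N) b)) = 1 := by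
  funext b; rw [Pi.zero_apply, expI_zero]; rfl

omit [NeZero N] in
/-- `exp iξ(0 + 0) = 1` as a configuration. [cite: Balaban1987RG1, (1.13) p.262 (bookkeeping)] -/
private theorem expI_zero_add_zero_cfg (ξ : ℝ) :
    (fun b : PBond P 0 => expI ξ ((0 : PBond P 0 → MatA N) b + (0 : PBond P 0 → MatA N) b)) = 1 := by
  funext b; rw [Pi.zero_apply, add_zero, expI_zero]; rfl

/-- The cost of the unit gauge transformation: `‖1‖·‖1⁻¹‖ ≤ e^{x}` for `0 ≤ x`. [folklore] -/
private theorem cost_one {x : ℝ} (hx : 0 ≤ x) (y : Site P 0) :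
    ‖((1 : Site P 0 → (MatA N)ˣ) y : MatA N)‖ * ‖(↑((1 : Site P 0 → (MatA N)ˣ) y)⁻¹ : MatA N)‖ ≤ Real.exp x := by
  simp only [Pi.one_apply, inv_one, Units.val_one, norm_one, mul_one]
  have := Real.add_one_le_exp x
  linarith

/-- **THE ZERO-LETTER `JInputs` AT THE FRAMES OF RECORD over ANY residual recipe obeying row P8** (every value of the variables): `Φ₀ = (1, 0)`, `𝐇 = H₁ = 0`, `ℓ = 0`, every gauge
transformation `1`, `ctr = id`, letters `𝐊 = 𝐀₂ = 0`; every identity field is read AT THE UNIT CONFIGURATION, where the residual laws give `1 = 1` ∕ `0 = 0`; the size fields are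
`0 < (positive)` ∕ `0 ≤ B₃|B′|`, the costs `1 ≤ e^{(≥ 0)}` (p585162's instance with its four unit-recipe faces replaced by row P8).  A witness for the BINDER; NOT print's letters.
[cite: Balaban1987RG1, (3.37)–(3.52) pp.277–280 (bookkeeping: the junk instance)] -/
private theorem nonempty_jInputs_zero (hRz : Rz.Laws) (lam : ResidB12Run P N M) {cB : ℝ} (hcB : 0 < cB)
    (hB₃ : 0 < lam.consts.B₃) (hO₁ : 0 < lam.consts.O₁) (hM : 0 < lam.consts.M) (hβ : 0 < lam.consts.β) (hα₀ : 0 < lam.consts.α₀) (hα₁ : 0 < lam.consts.α₁)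
    (hB'' : 0 ≤ lam.B₃'') (τ : ℝ) {n : ℝ} (hn : 0 ≤ n) :
    Nonempty (JInputs (suModel N) lam.consts (lam.frameX Rz) (lam.frameBox Rz) (lam.csX cB) (lam.csBox cB) lam.regionY (slProj N) lam.idx.η lam.B₃'' lam.α₀
      lam.idx.j τ n (0 : PBond P 0 → MatA N) (0 : PBond P 0 → MatA N)) := by
  have hL : 0 < lam.consts.L := Nat.cast_pos.mpr P.L_pos
  have hη : 0 < lam.idx.η := pow_pos (inv_pos.mpr (Nat.cast_pos.mpr P.L_pos)) _
  have hx : 0 < lam.consts.L ^ (lam.idx.j - 1) * lam.idx.η := by positivity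
  have hS1 : 0 < lam.consts.B₃ ^ 2 * lam.consts.O₁ * lam.consts.M * lam.consts.α₀ * (lam.consts.L ^ (lam.idx.j - 1) * lam.idx.η) := by positivity
  have hS2 : 0 < lam.consts.B₃ * (lam.consts.B₃ * lam.consts.O₁ * lam.consts.M * lam.consts.α₀ * (lam.consts.L ^ (lam.idx.j - 1) * lam.idx.η)) ^ 2 := by positivity
  have hS3 : 0 < lam.consts.β * lam.consts.α₀ * (lam.consts.L ^ (lam.idx.j - 1) * lam.idx.η) ^ 2 := by positivity
  have hα₀' : 0 < lam.α₀ := hα₀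
  have h2β : 0 < 1 + 2 * lam.consts.β := by positivity
  refine ⟨
    { Φ₀ := unitPair
      hΦ₀ := satisfies_unitPair_frameBox_of_laws hRz (suModel N) lam hcB (mul_pos h2β hα₀) (mul_pos h2β hα₁) hα₀'
      H := 0, H₁ := 0, ℓ := 0, uj := 1, ubar1 := 1, vj := 1, v := 1, ubar := fun _ => 1, w₁ := fun _ => 1
      ctr := fun _ x => x
      hKgc := fun _ => (suModel N).gc.zero_mem
      hAgc := fun _ => (suModel N).gc.zero_mem
      huj := cost_one (by positivity)
      hubar1 := cost_one (by positivity)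
      hvj := cost_one (by positivity)
      hv := cost_one (by positivity)
      hubar := fun _ _ => rfl
      h339 := fun p _ => by
        rw [expI_zero_cfg, bg_Un_frameBox_unitPair hRz, plaq_gaugeU, plaq_one, mul_one, mul_inv_cancel]
      h342 := fun b _ => by
        rw [expI_zero_cfg, B12Eq44Space.current_one, bg_Jn_frameBox_unitPair hRz, smul_zero, mul_zero, zero_mul]
      h338 := fun m _ _ p _ => by
        rw [expI_zero_add_zero_cfg, bg_Un_frameX_one hRz, plaq_gaugeU, plaq_one, mul_one, mul_inv_cancel]
      hJn := fun m _ _ b _ => by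
        rw [expI_zero_add_zero_cfg, bg_Jn_frameX_one hRz, inv_one, mul_one, gaugeU_one, B12Eq44Space.current_one]
      h338₁ := fun m _ _ p _ => by
        rw [bg_Un_frameX_one hRz, gaugeU_one]
      hJn₁ := fun m _ _ b _ => by
        rw [bg_Jn_frameX_one hRz, gaugeU_one, B12Eq44Space.current_one]
      hH := fun b => by rw [Pi.zero_apply, norm_zero]; exact hS1
      hHd := fun μ ν y => by
        simp only [grad, Pi.zero_apply, sub_self, smul_zero, norm_zero]
        exact hS1
      h45 := fun p _ => by
        simp only [Pi.zero_apply, add_zero, sub_self, smul_zero, norm_zero]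
        exact hS2
      hK := fun b => by rw [Pi.zero_apply, norm_zero]; exact hS1
      hKd := fun μ ν y => by
        simp only [grad, Pi.zero_apply, sub_self, smul_zero, norm_zero]
        exact hS1
      h45τ := fun p _ => by
        simp only [Pi.zero_apply, add_zero, sub_self, smul_zero, norm_zero]
        exact hS2
      hA := fun b => by rw [Pi.zero_apply, norm_zero]; positivity
      hAd := fun μ ν y => by
        simp only [grad, Pi.zero_apply, sub_self, smul_zero, norm_zero]
        positivity
      hS := fun b _ => by
        rw [sub_zero, B12CondIIIJConcreteModels.lapCur_zero, norm_zero]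
        exact hS3
      hSτ := fun b _ => by
        rw [smul_zero, sub_zero, B12CondIIIJConcreteModels.lapCur_zero, norm_zero]
        exact hS3
      hA2 := fun b _ => by
        rw [B12CondIIIJConcreteModels.lapCur_zero, norm_zero]
        positivity }⟩

/-- **THE PACKAGE IS INHABITED BY THE JUNK LETTERS `𝐊 = 𝐀₂ = 0` OVER ANY RESIDUAL RECIPE OBEYING ROW P8**: for a residual layer whose letters vanish identically, whose instance has
`X ⊆ □̃³` (the seven region fields are dag-n09-c's theorems — they do not read `bgI`) and whose constants satisfy «all the restrictions» and the seven further ones,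
`B12Package Rz cB λ` is inhabited whenever `Rz.Laws` (the by-reference `JInputs` := the zero-letter instance; analyticity of constant letters).  A witness for the BINDERS; NOT
print's letters; NOT a discharge of anything. [cite: Balaban1987RG1, Lemma 4 (3.53) p.280 with (3.26)–(3.52) pp.275–280 (bookkeeping: the junk instance)] -/
theorem nonempty_b12Package_of_laws_of_zero_letters (hRz : Rz.Laws) {cB : ℝ} (hcB : 0 < cB) (lam : ResidB12Run P N M)
    (hX3 : lam.idx.XSites ⊆ lam.idx.boxT 3)
    (hK : ∀ Φ A τ, lam.K Φ A τ = 0) (hA₂ : ∀ Φ A τ B', lam.A₂ Φ A τ B' = 0)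
    (hR : B12Sec2to5.Lemma4Restrictions lam.consts)
    (hB : 1 ≤ lam.consts.B₃) (hY : 1 ≤ lam.consts.B₃ ^ 2 * lam.consts.O₁ * lam.consts.M)
    (hα₁ : 16 * (lam.consts.O₁ * lam.consts.M * lam.consts.α₁) ≤ lam.consts.β) (hL10 : 1 + 10 * lam.consts.β ≤ lam.consts.L ^ 2)
    (hB'' : 0 ≤ lam.B₃'') (hres'' : lam.B₃'' * lam.consts.α₃ ≤ lam.consts.β * lam.consts.L⁻¹ ^ 2 * lam.consts.α₀)
    (hresJ : 4 * ((P.d - 1) * ((2 : ℝ) * C311 1)) * (lam.consts.B₃ ^ 2 * lam.consts.O₁ * lam.consts.M) ^ 2 * lam.consts.α₀ ≤ lam.consts.β) :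
    Nonempty (B12Package Rz cB lam) := by
  obtain ⟨hα₀, hα₁', -, -, hβ, -⟩ := hR
  have hB₃ : 0 < lam.consts.B₃ := one_pos.trans_le hB
  have hMnn : 0 ≤ lam.consts.M := Nat.cast_nonneg M
  have hOM : 0 < lam.consts.O₁ * lam.consts.M := by
    by_contra hle
    rw [not_lt] at hle
    have : lam.consts.B₃ ^ 2 * lam.consts.O₁ * lam.consts.M ≤ 0 := by
      rw [mul_assoc]; exact mul_nonpos_of_nonneg_of_nonpos (sq_nonneg _) hle
    linarith
  have hMpos : 0 < lam.consts.M := by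
    rcases hMnn.eq_or_lt with hM0 | hM0
    · rw [← hM0, mul_zero] at hOM; exact absurd hOM (lt_irrefl 0)
    · exact hM0
  have hO₁ : 0 < lam.consts.O₁ := by
    by_contra hle
    rw [not_lt] at hle
    have : lam.consts.O₁ * lam.consts.M ≤ 0 := mul_nonpos_iff.mpr (Or.inr ⟨hle, hMpos.le⟩)
    linarith
  refine ⟨
    { hB := hB, hY := hY, hα₁ := hα₁, hL10 := hL10, hB'' := hB'', hres'' := hres'', hresJ := hresJ
      hXb := lam.frameX_X_bonds_subset_regionY Rz hX3
      hXd := lam.frameX_X_dpairs_subset_regionY Rz hX3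
      hX₂b := lam.frameX_X₂_bonds_subset_regionY Rz hX3
      hX₂p := lam.frameX_X₂_plaqs_subset_X Rz
      hXp' := lam.frameX_X_plaqs_subset_frameBox_X₂ Rz hX3
      hYb' := lam.regionY_bonds_subset_frameBox_X₂ Rz
      hXp := lam.stencil_subset_regionY Rz hX3
      inputs := fun Φ A τ B' _ _ _ _ _ => by
        rw [hK, hA₂]
        exact Classical.choice (nonempty_jInputs_zero hRz lam hcB hB₃ hO₁ hMpos hβ hα₀ hα₁' hB'' τ (norm_nonneg B'))
      hKan := fun τ _ _ _ _ _ _ b => by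
        simp only [hK, Pi.zero_apply]
        exact analyticAt_const
      hA2an := fun τ _ _ _ _ _ _ b => by
        simp only [hA₂, Pi.zero_apply]
        exact analyticAt_const }⟩

/-- **★ THE HONEST HORN `B12Provisos` IS INHABITED OVER EVERY RESIDUAL RECIPE OBEYING ROW P8** (cube size `M ≥ 1`; `L ≥ 2` holds on every `Setup.Params`; `0 < O(1)LMB`): SOME residual
layer — dag-n09-c's `exists_residB12Run_restrictions` instance in the fundamental case `X ⊆ □̃²` with `(3.31) ∋ 0` and constants meeting every restriction, its letters REPLACED by
`𝐊 = 𝐀₂ = 0` — carries package ∧ restrictions ∧ `0 ∈ (3.31)` at `Rz`, for EVERY `Rz` with `Rz.Laws` (p585162's `exists_b12Provisos_of_eq_unit` is the case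
`Sect2.Residual.unit_laws`).  JUNK witness for the binders — it survives every pin of `bgI` keeping row P8. [cite: Balaban1987RG1, Lemma 4 p.280, §3 pp.276–280 («all the restrictions»), p.277 («At first let us take 𝐀 = 0») (bookkeeping)] -/
theorem exists_b12Provisos_of_laws (hRz : Rz.Laws) (hM : 1 ≤ M) {cB : ℝ} (hcB : 0 < cB) :
    ∃ lam : ResidB12Run P N M, lam.idx.XSites ⊆ lam.idx.boxT 2 ∧ (∀ Φ A τ, lam.K Φ A τ = 0) ∧ (∀ Φ A τ B', lam.A₂ Φ A τ B' = 0) ∧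
      B12Provisos Rz cB lam := by
  obtain ⟨lam, hX, h0, hR, hB, hY, hα₁, hL10, hB'', hres'', hresJ⟩ := exists_residB12Run_restrictions P N M hM P.hL.2
  refine ⟨{ lam with K := fun _ _ _ _ => 0, A₂ := fun _ _ _ _ _ => 0 }, hX, fun _ _ _ => rfl, fun _ _ _ _ => rfl, ⟨?_, hR, h0⟩⟩
  exact nonempty_b12Package_of_laws_of_zero_letters hRz hcB _ (IdxB12.XSites_subset_boxT_three_of_two _ hX) (fun _ _ _ => rfl) (fun _ _ _ _ => rfl)
    hR hB hY hα₁ hL10 hB'' hres'' hresJ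

/-- **★ THE «FAILING LEMMA» OF DIRECTOR-YM №209 IS FALSE AT EVERY RESIDUAL RECIPE OBEYING ROW P8**: it is NOT the case that no zero-letter residual layer satisfies `B12Provisos Rz cB λ`
(`M ≥ 1`, `0 < O(1)LMB`) — whatever `Rz.bgI` is, as long as `Rz.Laws`.  In particular the lemma cannot be delivered at any pin of `Sect2.Residual.bgI` to the [15]-minimisers of record
that keeps the record's proviso `rzLaws`.  LOCATED (re-aims FLAG №7 at the residual letters `λ.K ∕ λ.A₂` and the untied `JInputs.Φ₀ ∕ 𝐇`); count-neutral.
[cite: Balaban1987RG1, Lemma 4 p.280, (1.15)–(1.16) p.262 (bookkeeping)] -/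
theorem not_failingLemma_of_laws (hRz : Rz.Laws) (hM : 1 ≤ M) {cB : ℝ} (hcB : 0 < cB) :
    ¬ ∀ lam : ResidB12Run P N M, (∀ Φ A τ, lam.K Φ A τ = 0) → (∀ Φ A τ B', lam.A₂ Φ A τ B' = 0) → ¬ B12Provisos Rz cB lam := by
  intro h
  obtain ⟨lam, -, hK, hA₂, hP⟩ := exists_b12Provisos_of_laws (N := N) hRz hM hcB
  exact h lam hK hA₂ hP

/-- **★ … and the Lemma-4 LEAF follows for that zero-letter layer** (node00-def-B12's `B12Provisos.leaf`): N09's conjunct 1 in package form holds for SOME zero-letter `λ` at EVERY `Rz` with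
`Rz.Laws`.  LOCATED hollow-closure certificate; NOT Lemma 4 for print's letters. [cite: Balaban1987RG1, Lemma 4 (3.53) p.280 (bookkeeping)] -/
theorem exists_b12LeafOfRecord_of_laws (hRz : Rz.Laws) (hM : 1 ≤ M) {cB : ℝ} (hcB : 0 < cB) :
    ∃ lam : ResidB12Run P N M, (∀ Φ A τ, lam.K Φ A τ = 0) ∧ (∀ Φ A τ B', lam.A₂ Φ A τ B' = 0) ∧ B12LeafOfRecord Rz cB lam := by
  obtain ⟨lam, -, hK, hA₂, hP⟩ := exists_b12Provisos_of_laws (N := N) hRz hM hcB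
  exact ⟨lam, hK, hA₂, hP.leaf hcB⟩

end Junk

/-! ## §3. At EVERY Stage-12 parameter obeying row P8 (`∀ K, (θ.Rz K).Laws`) — no `HasResidualsOfRecord`, no `RzOfRecord` -/

section Stage12

variable {F : T4Family} {N : ℕ} [NeZero N]

/-- **★★ AT EVERY STAGE-12 PARAMETER OBEYING ROW P8** (`∀ K, (θ.Rz K).Laws` — e.g. `Provisos₁₂.rzLaws`; `0 < O(1)LMB = θ.s2.cB`, cube size `θ.τ9.M ≥ 1`): a residual [B12] layer `λ₁₂` ALL of
whose runs carry the honest horn `B12Provisos (θ.Rz P.K) θ.s2.cB (λ₁₂ P)` — with zero letters — WHATEVER the recipes `θ.Rz K` are (p585162's `…_of_hasResidualsOfRecord` is the case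
`θ.Rz = RzOfRecord`).  JUNK witness for the binders. [cite: Balaban1987RG1, Lemma 4 p.280 (bookkeeping)] -/
theorem exists_lam12_b12Provisos_of_rzLaws {θ : Stage12Params F N} (hRz : ∀ K, (θ.Rz K).Laws) (hcB : 0 < θ.s2.cB) (hM : 1 ≤ θ.τ9.M) :
    ∃ lam12 : ResidB12 F N θ.τ9.M, ∀ P : B12.RunParams,
      (lam12 P).idx.XSites ⊆ (lam12 P).idx.boxT 2 ∧ (∀ Φ A τ, (lam12 P).K Φ A τ = 0) ∧ (∀ Φ A τ B', (lam12 P).A₂ Φ A τ B' = 0) ∧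
        B12Provisos (θ.Rz P.K) θ.s2.cB (lam12 P) := by
  have hex : ∀ P : B12.RunParams, ∃ lam : ResidB12Run (F.P P.K) N θ.τ9.M,
      lam.idx.XSites ⊆ lam.idx.boxT 2 ∧ (∀ Φ A τ, lam.K Φ A τ = 0) ∧ (∀ Φ A τ B', lam.A₂ Φ A τ B' = 0) ∧ B12Provisos (θ.Rz P.K) θ.s2.cB lam :=
    fun P => exists_b12Provisos_of_laws (hRz P.K) hM hcB
  exact ⟨fun P => Classical.choose (hex P), fun P => Classical.choose_spec (hex P)⟩

/-- **★★ ⇒ N09's CONJUNCT 1 IN PACKAGE FORM IS CLOSABLE BY JUNK AT EVERY STAGE-12 PARAMETER OBEYING ROW P8**: SOME zero-letter residual [B12] layer `λ₁₂` has the Stage-12 leaf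
`B12LeafOfRecord₁₂ F N θ λ₁₂ P` at EVERY run — for EVERY choice of the residual background recipes `θ.Rz` with `rzLaws`.  LOCATED hollow-closure certificate — NOT Lemma 4 for print's
letters, NOT a discharge of N09, count-neutral. [cite: Balaban1987RG1, Lemma 4 (3.53) p.280 (bookkeeping)] -/
theorem exists_lam12_b12LeafOfRecord₁₂_of_rzLaws {θ : Stage12Params F N} (hRz : ∀ K, (θ.Rz K).Laws) (hcB : 0 < θ.s2.cB) (hM : 1 ≤ θ.τ9.M) :
    ∃ lam12 : ResidB12 F N θ.τ9.M, (∀ P : B12.RunParams, (∀ Φ A τ, (lam12 P).K Φ A τ = 0) ∧ (∀ Φ A τ B', (lam12 P).A₂ Φ A τ B' = 0)) ∧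
      ∀ P : B12.RunParams, B12LeafOfRecord₁₂ F N θ lam12 P := by
  obtain ⟨lam12, hlam⟩ := exists_lam12_b12Provisos_of_rzLaws hRz hcB hM
  exact ⟨lam12, fun P => ⟨(hlam P).2.1, (hlam P).2.2.1⟩, fun P => (hlam P).2.2.2.leaf hcB⟩

/-- **★★ THE SAME FROM THE RECORD'S OWN DISPLAYED PROVISOS, VERBATIM**: at every `θ : Stage12Params` with `θ.Provisos₁₂ F N` (row P8 `rzLaws` is a field) and `θ.Admissible F N` (the §2 sign
condition `0 < O(1)LMB` is a clause), cube size `≥ 1`, SOME zero-letter `λ₁₂` has the Stage-12 leaf at every run.  LOCATED; count-neutral. [cite: Balaban1987RG1, Lemma 4 (3.53) p.280 (bookkeeping)] -/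
theorem exists_lam12_b12LeafOfRecord₁₂_of_provisos₁₂ {θ : Stage12Params F N} (h : θ.Provisos₁₂ F N) (hθ : θ.Admissible F N) (hM : 1 ≤ θ.τ9.M) :
    ∃ lam12 : ResidB12 F N θ.τ9.M, (∀ P : B12.RunParams, (∀ Φ A τ, (lam12 P).K Φ A τ = 0) ∧ (∀ Φ A τ B', (lam12 P).A₂ Φ A τ B' = 0)) ∧
      ∀ P : B12.RunParams, B12LeafOfRecord₁₂ F N θ lam12 P :=
  exists_lam12_b12LeafOfRecord₁₂_of_rzLaws h.rzLaws hθ.pos.1 hM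

end Stage12

/-! ## §4. At the four-pin engine's `h09` socket: EVERY Stage-13 parameter obeying row P8, and EVERY parameter of K1⁷'s own antecedent class -/

section Socket

variable {F : T4Family} {N : ℕ} [NeZero N]

/-- **★★ AT THE X-PINNED STAGE-13 PARAMETER, FOR EVERY `θ` OBEYING ROW P8** (`∀ K, (θ.Rz K).Laws`, `0 < O(1)LMB`, cube size `≥ 1`): SOME zero-letter residual [B12] layer `λ₁₂` makes the
four-pin engine's N09 socket `h09 : ∀ P, Lemma4Printed ((θ.pinX3H λ₈ λ₁₂ λ₁₃).res.X P).F12 (…).c12` TRUE for EVERY `λ₈`, `λ₁₃` and every run (dag-n05-d's `socket09_pinX3H_iff`, `Iff.rfl`) —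
whatever `θ.Rz` is.  LOCATED hollow-closure certificate: the socket is met WITHOUT print's letters under ANY pin of `bgI` keeping `rzLaws`; N09 NOT discharged; K1⁷ NOT closed; count-neutral.
[cite: Balaban1987RG1, Lemma 4 (3.53) p.280 (bookkeeping)] -/
theorem exists_lam12_socket09_pinX3H_of_rzLaws {θ : Stage13Params F N} (hRz : ∀ K, (θ.Rz K).Laws) (hcB : 0 < θ.s2.cB) (hM : 1 ≤ θ.τ9.M) :
    ∃ lam12 : ResidB12 F N θ.τ9.M, (∀ P : B12.RunParams, (∀ Φ A τ, (lam12 P).K Φ A τ = 0) ∧ (∀ Φ A τ B', (lam12 P).A₂ Φ A τ B' = 0)) ∧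
      ∀ (lam8 : ResidB8 θ.toStage3Params) (lam13 : B12.RunParams → ResidB13 θ.toStage3Params) (P : B12.RunParams),
        B12Sec2to5.Lemma4Printed ((θ.pinX3H F N lam8 lam12 lam13).res.X P).F12 ((θ.pinX3H F N lam8 lam12 lam13).res.X P).c12 := by
  obtain ⟨lam12, hz, hleaf⟩ := exists_lam12_b12LeafOfRecord₁₂_of_rzLaws (θ := θ.toStage12Params) hRz hcB hM
  exact ⟨lam12, hz, fun lam8 lam13 P => (socket09_pinX3H_iff F N θ lam8 lam12 lam13 P).2 (hleaf P)⟩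

/-- `M = L^a ≥ 1` at a parameter of K1⁷'s class (`Provisos₁₃SepCoPH.hM`, `1 < L`). [cite: Balaban1988Convergent, p.245 («M = L^m») (bookkeeping)] -/
theorem one_le_M_of_provisos₁₃SepCoPH {θ : Stage13HParams F N} (h : θ.Provisos₁₃SepCoPH F N) : 1 ≤ θ.τ9.M := by
  obtain ⟨a, ha⟩ := h.hM
  rw [ha]
  exact Nat.one_le_pow _ _ (by have := F.hL.2; omega)

/-- **★★★ AT EVERY PARAMETER OF K1⁷'s OWN ANTECEDENT CLASS** (`θ : Stage13HParams`, `θ.Provisos₁₃SepCoPH F N` — row P8 `rzLaws` and `M = L^a` are fields — and `θ.Admissible F N` — `0 < O(1)LMB` is a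
clause): SOME zero-letter residual [B12] layer `λ₁₂` has the Stage-12 leaf `B12LeafOfRecord₁₂` at EVERY run, WHATEVER the residual background recipes `θ.Rz` of the parameter are (unit
recipe, a pin to the [15]-minimisers, anything obeying P8).  LOCATED hollow-closure certificate for the K1⁷ road: the crux's hypothesis class cannot tell print's Lemma-4 letters from zero
letters at N09's conjunct 1; NOT Lemma 4 for print's letters; N09 NOT discharged; K1⁷ NOT closed; count-neutral. [cite: Balaban1987RG1, Lemma 4 (3.53) p.280; Balaban1988Convergent, (2.18) p.257 (the class, bookkeeping)] -/
theorem exists_lam12_b12LeafOfRecord₁₂_of_provisos₁₃SepCoPH {θ : Stage13HParams F N} (h : θ.Provisos₁₃SepCoPH F N) (hθ : θ.Admissible F N) :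
    ∃ lam12 : ResidB12 F N θ.τ9.M, (∀ P : B12.RunParams, (∀ Φ A τ, (lam12 P).K Φ A τ = 0) ∧ (∀ Φ A τ B', (lam12 P).A₂ Φ A τ B' = 0)) ∧
      ∀ P : B12.RunParams, B12LeafOfRecord₁₂ F N θ.toStage12Params lam12 P :=
  exists_lam12_b12LeafOfRecord₁₂_of_rzLaws (θ := θ.toStage12Params) h.rzLaws hθ.1.pos.1 (one_le_M_of_provisos₁₃SepCoPH h)

/-- **★★★ … AND MEETS THE FOUR-PIN ENGINE'S N09 SOCKET AT `θ.pinX3H λ₈ λ₁₂ λ₁₃`** for every `λ₈`, `λ₁₃`, every run — at EVERY parameter of K1⁷'s antecedent class (`Provisos₁₃SepCoPH ∧ Admissible`),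
whatever its `Rz`.  LOCATED hollow-closure certificate; NOT Lemma 4 for print's letters; N09 NOT discharged; K1⁷ NOT closed; count-neutral.
[cite: Balaban1987RG1, Lemma 4 (3.53) p.280; Balaban1988Convergent, (2.18) p.257 (the class, bookkeeping)] -/
theorem exists_lam12_socket09_pinX3H_of_provisos₁₃SepCoPH {θ : Stage13HParams F N} (h : θ.Provisos₁₃SepCoPH F N) (hθ : θ.Admissible F N) :
    ∃ lam12 : ResidB12 F N θ.τ9.M, (∀ P : B12.RunParams, (∀ Φ A τ, (lam12 P).K Φ A τ = 0) ∧ (∀ Φ A τ B', (lam12 P).A₂ Φ A τ B' = 0)) ∧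
      ∀ (lam8 : ResidB8 θ.toStage3Params) (lam13 : B12.RunParams → ResidB13 θ.toStage3Params) (P : B12.RunParams),
        B12Sec2to5.Lemma4Printed ((θ.toStage13Params.pinX3H F N lam8 lam12 lam13).res.X P).F12 ((θ.toStage13Params.pinX3H F N lam8 lam12 lam13).res.X P).c12 :=
  exists_lam12_socket09_pinX3H_of_rzLaws (θ := θ.toStage13Params) h.rzLaws hθ.1.pos.1 (one_le_M_of_provisos₁₃SepCoPH h)

end Socket

end Summit.QuantumFields.YangMills.BalabanUVNodes.N09B12ProvisosJunkUnderRzLaws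

end
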